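import Summits.MatrixMultiplication.MatrixMultiplication.Theorems.FarEdgeDescentRankOneCoupling
import HarnessLib

/-!
# Far-edge descent, Kernel X-b — pointwise spectral dichotomy on the BCZ stratum line

Support for `Summit.MatrixMultiplication.MatrixMultiplication.Theses.FarEdgeDescent`
(aside `SubLogRate`; lens «structural dichotomy (special vs generic)», generation 35).

`FarEdgeDescentGenericDomination` proved the special/generic dichotomy of the stratum line
`q ↦ 𝔖(q)` for **asymptotic rank**: every sublevel set `{q : R̃(𝔖(q)) ≤ r}` is all of `ℂ` or
finite, a dominant (generic) member exists, the special members are countably many.  The engine was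
CHNVZ's theorem that `{T : R̃(T) ≤ r}` is Zariski-closed.  CHNVZ observe (§3 of [CHNVZ]) that the
same holds for **every point `Φ` of Strassen's asymptotic spectrum** — `Φ` is an admissible
functional equal to its own regularisation — and this file proves it in the tree's coordinates and
runs the whole dichotomy *pointwise in `Φ`*:

* **Zariski semicontinuity of universal spectral points** (Thm. A, `spectralPoint_le_of_zariski`):
  if every polynomial vanishing on `A` vanishes at `T` and `Φ ≤ s` on `A`, then `Φ(T) ≤ s`
  (CHNVZ Lemma 2.3: `T^{⊠n} ∈ span A^{⊠n}` with `≤ (n+1)^{dim}` terms, subadditivity of `Φ` under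
  sums from the companion file `FarEdgeDescentRankOneCoupling`, multiplicativity, and the
  polynomial-versus-exponential comparison);
* **pointwise sublevel dichotomy on lines** (Thm. B, `spectral_sublevel_eq_univ_or_finite`): for
  every `Φ`, every line `q ↦ t₀ + q • t₁` over any field and every level `s`, the set
  `{q : Φ(t₀ + q • t₁) ≤ s}` is the whole field or finite;
* hence over `ℂ` (Thm. C/D): for every `Φ` a **`Φ`-dominant member** `𝔖(q_Φ)` exists, the
  `Φ`-special members are countably many, finitely many below each attained level, and — by the
  rank-one coupling — `Φ(𝔖(1)) ≤ Φ(𝔖(q_Φ)) ≤ Φ(𝔖(1)) + 1`; under the summit `ω = 2` each `Φ` is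
  either `≡ 4` on `q ≠ 0` with `Φ(𝔖(0)) ≤ 4`, or `> 4` off a finite set containing `1`, with all
  values `≤ 5` (`spectral_summit_dichotomy`).

## References

* M. Christandl, K. Hoeberechts, H. Nieuwboer, P. Vrana, J. Zuiddam, *Asymptotic tensor rank is
  characterized by polynomials*, arXiv:2411.15789: Def. 2.1, Thm. 2.2, Lemma 2.3, Cor. 2.4, and §3
  ("for every `F` in the asymptotic spectrum … `{T : F(T) ≤ r}` is Zariski-closed").
  [ChristandlHoeberechtsNieuwboerVranaZuiddam2025]
* V. Strassen, *The asymptotic spectrum of tensors*, J. reine angew. Math. 384 (1988). [Strassen1988]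
* M. Bläser, M. Christandl, J. Zuiddam, arXiv:1705.09652 (2017), §2 Def. 5. [BlaserChristandlZuiddam2017]
-/

noncomputable section

open scoped BigOperators Polynomial

set_option linter.dupNamespace false

namespace Summit.MatrixMultiplication.MatrixMultiplication.Theorems.FarEdgeDescentSpectralSublevel

open Literature.Computability.AlgebraicComplexity
open Summit.MatrixMultiplication.MatrixMultiplication.Theorems.FarEdgeDescentSignTwist
open Summit.MatrixMultiplication.MatrixMultiplication.Theorems.FarEdgeDescentSignTwistDet
open Summit.MatrixMultiplication.MatrixMultiplication.Theorems.FarEdgeDescentWeightFamily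
open Summit.MatrixMultiplication.MatrixMultiplication.Theorems.FarEdgeDescentSupportStratumDoor
open Summit.MatrixMultiplication.MatrixMultiplication.Theorems.FarEdgeDescentStratumPinning
open Summit.MatrixMultiplication.MatrixMultiplication.Theorems.FarEdgeDescentGenericDomination
open Summit.MatrixMultiplication.MatrixMultiplication.Theorems.FarEdgeDescentRankOneCoupling

/-! ## §A Zariski semicontinuity of universal spectral points -/

section Zariski

variable {F : Type} [Field F] {ι κ μ : Type} [Fintype ι] [Fintype κ] [Fintype μ]
  [DecidableEq ι] [DecidableEq κ] [DecidableEq μ]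

/-- **Zariski semicontinuity of universal spectral points** (CHNVZ Thm. 2.2 for points of the
asymptotic spectrum, cf. their §3): if every polynomial in the tensor entries vanishing on `A`
vanishes at `T`, and `Φ ≤ s` on `A` for a universal spectral point `Φ`, then `Φ(T) ≤ s`.
Proof: `T^{⊠n} = ∑_{i<ν} αᵢ Sᵢ^{⊠n}` with `Sᵢ ∈ A`, `ν ≤ (n+1)^{|ι×κ×μ|}` (CHNVZ Lemma 2.3), so
`Φ(T)^n ≤ ∑ᵢ Φ(Sᵢ)^n ≤ (n+1)^{|ι×κ×μ|} s^n` for all `n`.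
[cite: ChristandlHoeberechtsNieuwboerVranaZuiddam2025, Theorem 2.2, Lemma 2.3, §3] -/
theorem spectralPoint_le_of_zariski {Φ : SpectralMap F} (hΦ : IsUniversalSpectralPoint F Φ)
    (A : Set (ι → κ → μ → F)) (T : ι → κ → μ → F)
    (hZ : ∀ p : MvPolynomial (ι × κ × μ) F,
      (∀ S ∈ A, MvPolynomial.eval (tensorEntries S) p = 0) →
        MvPolynomial.eval (tensorEntries T) p = 0)
    {s : ℝ} (hs : 0 ≤ s) (hA : ∀ S ∈ A, Φ S ≤ s) : Φ T ≤ s := by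
  classical
  refine le_of_forall_pow_le_polynomial_mul_pow (Φ T) s 1 (Fintype.card (ι × κ × μ)) hs fun n => ?_
  obtain ⟨ν, S, α, hν, hS, hT⟩ :=
    exists_eq_sum_smul_kroneckerPow A n (kroneckerPow_mem_span_of_forall_eval_eq_zero A T hZ n)
  have h₁ : Φ T ^ n = Φ (kroneckerPow T n) := (hΦ.map_kroneckerPow T n).symm
  have h₂ : Φ (kroneckerPow T n) ≤ ∑ i : Fin ν, Φ (α i • kroneckerPow (S i) n) := by
    rw [hT]
    exact spectralPoint_sum_le hΦ Finset.univ (fun i => α i • kroneckerPow (S i) n)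
  have h₃ : ∀ i : Fin ν, Φ (α i • kroneckerPow (S i) n) ≤ s ^ n := fun i =>
    (spectralPoint_smul_le hΦ (α i) _).trans (by
      rw [hΦ.map_kroneckerPow]
      exact pow_le_pow_left₀ (hΦ.nonneg _) (hA _ (hS i)) n)
  have h₄ : ∑ i : Fin ν, Φ (α i • kroneckerPow (S i) n) ≤ (ν : ℝ) * s ^ n := by
    have h := Finset.sum_le_sum fun i (_ : i ∈ (Finset.univ : Finset (Fin ν))) => h₃ i
    simpa using h
  have h₅ : (ν : ℝ) ≤ ((n : ℝ) + 1) ^ Fintype.card (ι × κ × μ) := by exact_mod_cast hν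
  calc Φ T ^ n = Φ (kroneckerPow T n) := h₁
    _ ≤ (ν : ℝ) * s ^ n := h₂.trans h₄
    _ ≤ ((n : ℝ) + 1) ^ Fintype.card (ι × κ × μ) * s ^ n :=
        mul_le_mul_of_nonneg_right h₅ (pow_nonneg hs n)
    _ = 1 * ((n : ℝ) + 1) ^ Fintype.card (ι × κ × μ) * s ^ n := by ring

/-- **Sublevel sets of universal spectral points are Zariski-closed** (CHNVZ Cor. 2.4 / §3), in the
form: the Zariski closure of `{Φ ≤ s}` is contained in `{Φ ≤ s}`.
[cite: ChristandlHoeberechtsNieuwboerVranaZuiddam2025, Corollary 2.4, §3] -/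
theorem spectralPoint_le_of_zariski_sublevel {Φ : SpectralMap F} (hΦ : IsUniversalSpectralPoint F Φ)
    (s : ℝ) (T : ι → κ → μ → F)
    (hZ : ∀ p : MvPolynomial (ι × κ × μ) F,
      (∀ S : ι → κ → μ → F, Φ S ≤ s → MvPolynomial.eval (tensorEntries S) p = 0) →
        MvPolynomial.eval (tensorEntries T) p = 0) : Φ T ≤ s := by
  rcases lt_or_ge s 0 with hs | hs
  · -- the sublevel set is empty, so `p = 1` vanishes on it: contradiction
    have h := hZ 1 (fun S hS => absurd (hS.trans_lt hs) (not_lt.2 (hΦ.nonneg S)))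
    simp at h
  · exact spectralPoint_le_of_zariski hΦ {S | Φ S ≤ s} T (fun p hp => hZ p fun S hS => hp S hS) hs
      fun S hS => hS

end Zariski

/-! ## §B Pointwise sublevel dichotomy on affine lines -/

section Line

variable {F : Type} [Field F] {ι κ μ : Type} [Fintype ι] [Fintype κ] [Fintype μ]
  [DecidableEq ι] [DecidableEq κ] [DecidableEq μ]

/-- **Pointwise sublevel dichotomy on a line**: for every universal spectral point `Φ`, every line
`q ↦ t₀ + q • t₁` and every level `s`, the set `{q : Φ(t₀ + q • t₁) ≤ s}` is the whole field or
finite. [cite: ChristandlHoeberechtsNieuwboerVranaZuiddam2025, Corollary 2.4, §3] -/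
theorem spectral_sublevel_eq_univ_or_finite {Φ : SpectralMap F} (hΦ : IsUniversalSpectralPoint F Φ)
    (t₀ t₁ : ι → κ → μ → F) (s : ℝ) :
    {q : F | Φ (t₀ + q • t₁) ≤ s} = Set.univ ∨ {q : F | Φ (t₀ + q • t₁) ≤ s}.Finite := by
  classical
  by_cases hall : ∀ p : MvPolynomial (ι × κ × μ) F,
      (∀ S : ι → κ → μ → F, Φ S ≤ s → MvPolynomial.eval (tensorEntries S) p = 0) →
        MvPolynomial.aeval (fun x => Polynomial.C (tensorEntries t₀ x) +
          Polynomial.X * Polynomial.C (tensorEntries t₁ x)) p = 0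
  · refine Or.inl (Set.eq_univ_of_forall fun q => ?_)
    refine spectralPoint_le_of_zariski_sublevel hΦ s (t₀ + q • t₁) fun p hp => ?_
    rw [← eval_aeval_line, hall p hp, Polynomial.eval_zero]
  · push Not at hall
    obtain ⟨p, hp, hp0⟩ := hall
    refine Or.inr ((Polynomial.finite_setOf_isRoot hp0).subset fun q hq => ?_)
    show Polynomial.eval q _ = 0
    rw [eval_aeval_line]
    exact hp _ hq

/-- Finitely many parameters strictly below an attained `Φ`-value.
[cite: ChristandlHoeberechtsNieuwboerVranaZuiddam2025, Corollary 2.4] -/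
theorem spectral_finite_sublevel_of_lt {Φ : SpectralMap F} (hΦ : IsUniversalSpectralPoint F Φ)
    {t₀ t₁ : ι → κ → μ → F} {q₀ : F} {c : ℝ} (hc : c < Φ (t₀ + q₀ • t₁)) :
    {q : F | Φ (t₀ + q • t₁) ≤ c}.Finite :=
  (spectral_sublevel_eq_univ_or_finite hΦ t₀ t₁ c).resolve_left fun huniv =>
    not_le.2 hc (show q₀ ∈ {q : F | Φ (t₀ + q • t₁) ≤ c} from huniv ▸ Set.mem_univ q₀)

/-- **Abstract dominance lemma**: a real function on an uncountable type all of whose sublevel sets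
are "everything or finite" attains its maximum. [folklore] -/
theorem exists_max_of_sublevel_dichotomy {X : Type*} (hX : ¬ (Set.univ : Set X).Countable)
    (v : X → ℝ) (hv : ∀ r : ℝ, {x | v x ≤ r} = Set.univ ∨ {x | v x ≤ r}.Finite) :
    ∃ x₀, ∀ x, v x ≤ v x₀ := by
  by_contra h
  push Not at h
  have hfin : ∀ x₀ : X, {x : X | v x ≤ v x₀}.Finite := by
    intro x₀
    refine (hv (v x₀)).resolve_left fun huniv => ?_
    obtain ⟨x, hx⟩ := h x₀
    exact not_lt.2 (show x ∈ {x : X | v x ≤ v x₀} from huniv ▸ Set.mem_univ x) hx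
  have hV : (Set.range v).Countable := by
    refine countable_of_finite_initialSegments fun c hc => ?_
    obtain ⟨x₀, rfl⟩ := hc
    refine ((hfin x₀).image v).subset ?_
    rintro _ ⟨⟨x, rfl⟩, hle⟩
    exact ⟨x, hle, rfl⟩
  have hcover : (Set.univ : Set X) ⊆ ⋃ c ∈ Set.range v, {x : X | v x ≤ c} := fun x _ =>
    Set.mem_biUnion (Set.mem_range_self x) (show x ∈ {x' : X | v x' ≤ v x} from le_refl (v x))
  refine hX (Set.Countable.mono hcover (hV.biUnion fun c hc => ?_))
  obtain ⟨x₀, rfl⟩ := hc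
  exact (hfin x₀).countable

/-- **Abstract countability of the special set**: under the sublevel dichotomy, strictly below any
attained value there are only countably many points. [folklore] -/
theorem countable_lt_of_sublevel_dichotomy {X : Type*} (v : X → ℝ)
    (hv : ∀ r : ℝ, {x | v x ≤ r} = Set.univ ∨ {x | v x ≤ r}.Finite) (x₀ : X) :
    {x : X | v x < v x₀}.Countable := by
  set N : Set X := {x : X | v x < v x₀} with hN
  have hfin : ∀ x' ∈ N, {x : X | v x ≤ v x'}.Finite := fun x' hx' =>
    (hv (v x')).resolve_left fun huniv => by
      have hmem : x₀ ∈ {x : X | v x ≤ v x'} := huniv ▸ Set.mem_univ x₀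
      have hle : v x₀ ≤ v x' := hmem
      exact not_le.2 hx' hle
  have hV : (v '' N).Countable := by
    refine countable_of_finite_initialSegments fun c hc => ?_
    obtain ⟨x', hx', rfl⟩ := hc
    refine ((hfin x' hx').image v).subset ?_
    rintro _ ⟨⟨x, -, rfl⟩, hle⟩
    exact ⟨x, hle, rfl⟩
  have hcover : N ⊆ ⋃ c ∈ v '' N, {x : X | v x ≤ c} := fun x hx =>
    Set.mem_biUnion ⟨x, hx, rfl⟩ (show x ∈ {x' : X | v x' ≤ v x} from le_refl (v x))
  exact Set.Countable.mono hcover (hV.biUnion fun c hc => by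
    obtain ⟨x', hx', rfl⟩ := hc
    exact (hfin x' hx').countable)

/-- **A `Φ`-dominant parameter exists on every line over an uncountable field.**
[cite: ChristandlHoeberechtsNieuwboerVranaZuiddam2025, Corollary 4.4] -/
theorem exists_spectral_dominant (hF : ¬ (Set.univ : Set F).Countable) {Φ : SpectralMap F}
    (hΦ : IsUniversalSpectralPoint F Φ) (t₀ t₁ : ι → κ → μ → F) :
    ∃ q₀ : F, ∀ q : F, Φ (t₀ + q • t₁) ≤ Φ (t₀ + q₀ • t₁) :=
  exists_max_of_sublevel_dichotomy hF (fun q => Φ (t₀ + q • t₁))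
    (spectral_sublevel_eq_univ_or_finite hΦ t₀ t₁)

/-- **Countably many `Φ`-special parameters** below any attained value.
[cite: ChristandlHoeberechtsNieuwboerVranaZuiddam2025, Corollary 2.4] -/
theorem countable_spectral_special {Φ : SpectralMap F} (hΦ : IsUniversalSpectralPoint F Φ)
    (t₀ t₁ : ι → κ → μ → F) (q₀ : F) :
    {q : F | Φ (t₀ + q • t₁) < Φ (t₀ + q₀ • t₁)}.Countable :=
  countable_lt_of_sublevel_dichotomy (fun q => Φ (t₀ + q • t₁))
    (spectral_sublevel_eq_univ_or_finite hΦ t₀ t₁) q₀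

end Line

/-! ## §C/D The BCZ line over `ℂ`, pointwise in `Φ` -/

section BCZ

variable {Φ : SpectralMap ℂ}

/-- **Pointwise sublevel dichotomy on the BCZ line**: for every universal spectral point `Φ` and
level `s`, `{q : Φ(𝔖(q)) ≤ s}` is all of `ℂ` or finite.
[cite: ChristandlHoeberechtsNieuwboerVranaZuiddam2025, Corollary 2.4, §3] -/
theorem spectral_flatLocus_eq_univ_or_finite (hΦ : IsUniversalSpectralPoint ℂ Φ) (s : ℝ) :
    {q : ℂ | Φ (fam ℂ q) ≤ s} = Set.univ ∨ {q : ℂ | Φ (fam ℂ q) ≤ s}.Finite := by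
  simpa only [line_eq_fam] using
    spectral_sublevel_eq_univ_or_finite hΦ (fam ℂ 0) (fam ℂ 1 - fam ℂ 0) s

/-- **A `Φ`-dominant member exists** for every universal spectral point `Φ`.
[cite: ChristandlHoeberechtsNieuwboerVranaZuiddam2025, Corollary 4.4] -/
theorem exists_spectral_dominant_fam (hΦ : IsUniversalSpectralPoint ℂ Φ) :
    ∃ q₀ : ℂ, ∀ q, Φ (fam ℂ q) ≤ Φ (fam ℂ q₀) := by
  simpa only [line_eq_fam] using
    exists_spectral_dominant not_countable_complex hΦ (fam ℂ 0) (fam ℂ 1 - fam ℂ 0)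

/-- **Countably many `Φ`-special members.** [cite: ChristandlHoeberechtsNieuwboerVranaZuiddam2025, Corollary 2.4] -/
theorem countable_spectral_special_fam (hΦ : IsUniversalSpectralPoint ℂ Φ) (q₀ : ℂ) :
    {q : ℂ | Φ (fam ℂ q) < Φ (fam ℂ q₀)}.Countable := by
  simpa only [line_eq_fam] using
    countable_spectral_special hΦ (fam ℂ 0) (fam ℂ 1 - fam ℂ 0) q₀

/-- **Finitely many members strictly below any attained `Φ`-level.**
[cite: ChristandlHoeberechtsNieuwboerVranaZuiddam2025, Corollary 2.4] -/
theorem finite_spectral_special_fam_below (hΦ : IsUniversalSpectralPoint ℂ Φ) {q₀ : ℂ} {c : ℝ}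
    (hc : c < Φ (fam ℂ q₀)) : {q : ℂ | Φ (fam ℂ q) ≤ c}.Finite := by
  have h := spectral_finite_sublevel_of_lt hΦ (t₀ := fam ℂ 0) (t₁ := fam ℂ 1 - fam ℂ 0)
    (q₀ := q₀) (c := c) (by simpa only [line_eq_fam] using hc)
  simpa only [line_eq_fam] using h

/-- **`Φ`-generic window**: a `Φ`-dominant member satisfies
`Φ(𝔖(1)) ≤ Φ(𝔖(q_Φ)) ≤ Φ(𝔖(1)) + 1` (domination of the summit member and rank-one coupling).
[cite: BlaserChristandlZuiddam2017, §2; ChristandlHoeberechtsNieuwboerVranaZuiddam2025, §3] -/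
theorem spectral_generic_window (hΦ : IsUniversalSpectralPoint ℂ Φ) {q₀ : ℂ}
    (hq₀ : ∀ q, Φ (fam ℂ q) ≤ Φ (fam ℂ q₀)) :
    Φ (fam ℂ 1) ≤ Φ (fam ℂ q₀) ∧ Φ (fam ℂ q₀) ≤ Φ (fam ℂ 1) + 1 :=
  ⟨hq₀ 1, spectralPoint_fam_le_add_one hΦ q₀ 1⟩

/-- **The `Φ`-generic value is universal-spectrum-sized**: `Φ(𝔖(q_Φ)) ≤ 2^ω + 1`.
[cite: Strassen1988, Thm. 3.9; BlaserChristandlZuiddam2017, §2] -/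
theorem spectral_dominant_le (hΦ : IsUniversalSpectralPoint ℂ Φ) (q₀ : ℂ) :
    Φ (fam ℂ q₀) ≤ (2 : ℝ) ^ omega ℂ + 1 :=
  spectralPoint_fam_le_rpow_omega_add_one hΦ q₀

/-- **Pointwise summit dichotomy.** Under `ω = 2`, for every universal spectral point `Φ`: either
`Φ(𝔖(q)) ≤ 4` for every `q` (so `Φ ≡ 4` on `q ≠ 0`), or the set `{q : Φ(𝔖(q)) ≤ 4}` is finite,
contains `q = 1`, and `Φ(𝔖(q)) ≤ 5` everywhere.
[cite: ChristandlHoeberechtsNieuwboerVranaZuiddam2025, §3; BlaserChristandlZuiddam2017, §2] -/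
theorem spectral_summit_dichotomy (hS : _root_.MatrixMultiplication) (hΦ : IsUniversalSpectralPoint ℂ Φ) :
    (∀ q : ℂ, Φ (fam ℂ q) ≤ 4) ∨
      ({q : ℂ | Φ (fam ℂ q) ≤ 4}.Finite ∧ (1 : ℂ) ∈ {q : ℂ | Φ (fam ℂ q) ≤ 4} ∧
        ∀ q : ℂ, Φ (fam ℂ q) ≤ 5) := by
  have h1 : Φ (fam ℂ 1) ≤ 4 := (spectralPoint_fam_one_eq_four_of_summit hS hΦ).le
  rcases spectral_flatLocus_eq_univ_or_finite hΦ 4 with h | h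
  · left
    intro q
    have hq : q ∈ {q : ℂ | Φ (fam ℂ q) ≤ 4} := by rw [h]; trivial
    exact hq
  · exact Or.inr ⟨h, h1, spectralPoint_fam_le_five_of_summit hS hΦ⟩

/-- **Pointwise summit dichotomy, nonzero weights**: under `ω = 2`, either `Φ(𝔖(q)) = 4` for all
`q ≠ 0`, or `4 < Φ(𝔖(q)) ≤ 5` for all but finitely many `q`.
[cite: ChristandlHoeberechtsNieuwboerVranaZuiddam2025, §3; BlaserChristandlZuiddam2017, §2] -/
theorem spectral_summit_dichotomy' (hS : _root_.MatrixMultiplication) (hΦ : IsUniversalSpectralPoint ℂ Φ) :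
    (∀ q : ℂ, q ≠ 0 → Φ (fam ℂ q) = 4) ∨
      ({q : ℂ | ¬ (4 < Φ (fam ℂ q) ∧ Φ (fam ℂ q) ≤ 5)}.Finite) := by
  rcases spectral_summit_dichotomy hS hΦ with h | ⟨hfin, -, h5⟩
  · exact Or.inl fun q hq => le_antisymm (h q) (spectralPoint_fam_mem_Icc_of_summit hS hΦ hq).1
  · refine Or.inr (hfin.subset fun q hq => ?_)
    simp only [Set.mem_setOf_eq, not_and_or, not_lt, not_le] at hq ⊢
    rcases hq with hq | hq
    · exact hq
    · exact absurd (h5 q) (not_le.2 hq)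

/-- **`Φ`-special members under the summit are the flat ones**: if `ω = 2` and `Φ` is not `≤ 4`
along the whole line, then the `Φ`-dominant value exceeds `4` and every `q` with `Φ(𝔖(q)) ≤ 4`
(in particular `q = 1`) is `Φ`-special. [cite: ChristandlHoeberechtsNieuwboerVranaZuiddam2025, §3] -/
theorem four_lt_spectral_dominant_of_not_flat (hS : _root_.MatrixMultiplication)
    (hΦ : IsUniversalSpectralPoint ℂ Φ) (h : ¬ ∀ q : ℂ, Φ (fam ℂ q) ≤ 4) {q₀ : ℂ}
    (hq₀ : ∀ q, Φ (fam ℂ q) ≤ Φ (fam ℂ q₀)) :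
    4 < Φ (fam ℂ q₀) ∧ Φ (fam ℂ q₀) ≤ 5 ∧ Φ (fam ℂ 1) < Φ (fam ℂ q₀) := by
  push Not at h
  obtain ⟨q, hq⟩ := h
  have h4 : 4 < Φ (fam ℂ q₀) := hq.trans_le (hq₀ q)
  exact ⟨h4, spectralPoint_fam_le_five_of_summit hS hΦ q₀,
    (spectralPoint_fam_one_eq_four_of_summit hS hΦ).trans_lt h4⟩

end BCZ

end Summit.MatrixMultiplication.MatrixMultiplication.Theorems.FarEdgeDescentSpectralSublevel

end
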